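import Summits.AtomisticToContinuum.Crystallization.Theorems.ChartedZeroExcessLayeredLatticeLiouvilleZZZYH

/-!
# ChartedZeroExcess · LayeredLatticeLiouville ZZZYI (lens-2 g93 NODE 93 «BregmanCapture») — THE SOFT LEAF (OGˢ′⋆) CUT INTO A KINEMATIC CAPTURE
# AND A LOCAL BREGMAN COERCIVITY OF THE CLAMPED ENERGY AT THE CRITICAL FILLING, GLUED BY THE PROVED EXIT MASS; FIRST ANALYTIC LEMMAS PROVED.
Docket `stmt-AtomisticToContinuum-26636` (crux `ChartedZeroExcessLayered`), W2 line; residual of record after g92/g92b (critic r1630/r1631): (X1ᴸ′), (X2ᴸ′),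
(OGˢ′⋆) `OffTubeSoftGapMinP … (121/25) (249/10000) g₀ …`, (OGʰ′⋆), door `mildCoherentMoatCorePG_W2g_record` (tree ZZZYH).  THIS FILE (all PROVED, 0 sorry):
* (K) RIDER r2 — THE THREE EXIT BRANCHES FOLD (PROVED).  Tree (BXᴸ′)·(UXᴸ′) (ZZZYA) make the BOND exit fire off the outer tube at the record dials, so of
  the three branches of `exit_by_motion_record` only the first is live; for a SOFT core it reads: some `Rg`-label pair has bond deviation `> sb` from the
  label crystal, hence `> sb − sb₁` from the filling `y` — ONE term of the pair-deviation energy `pairDevSq` already weighs `(sb − sb₁)²`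
  (`exitMass_le_pairDevSq`) — and EVERY soft witness field rotates that star's reference bond by `> sb − sb₁ − τ ≥ sb/4` (`exists_rotatedStar_of_soft_record`).
* (E) THE EXACT SECOND-ORDER LEDGER OF ONE BOND (PROVED, the first analytic lemma).  For any pair potential `φ` with derivative table `φ'`:
  `φ ‖b + v‖ − φ ‖b‖ − (φ' ‖b‖/‖b‖)⟪b, v⟫ = φ' ‖b‖ · bondExcess b v + bondBregman φ φ' ‖b‖ ‖b + v‖` (`pair_ledger`), the TRANSVERSE EXCESS
  `bondExcess b v = ‖b + v‖ − ‖b‖ − ⟪b, v⟫/‖b‖` obeying `0 ≤ bondExcess b v ≤ ‖v‖²/‖b‖` for `b ≠ 0` with NO smallness of `v` (`bondExcess_nonneg`, `bondExcess_le_sq_div`), `bondBregman` the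
  scalar Bregman remainder of `φ`; in the tree's terms `lennardJones ‖x + v − q‖ − lennardJones ‖x − q‖ − pairDeriv x q v = ljDeriv ‖x − q‖ · bondExcess (x − q) v + bondBregman …`
  (`lennardJones_pair_ledger`).  Summed over the bonds of a CRITICAL filling the linear terms cancel: `E(z) − E(y)` IS the Bregman divergence of the clamped
  energy at `y`, bondwise = TENSION × EXCESS (sign of `φ'`, `≤ |φ'|/ℓ · |Δw|²`, g92's TERM A) + STRETCH BREGMAN (TERM B).
* THE CUT (one layer beneath (OGˢ′⋆), two typed pieces, glue PROVED): **(KAᴸ) `SoftCaptureP`** — KINEMATIC, LJ-free: a core that is `τ`-soft about an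
  inner-tube filling lies in the FAT tube `(sb⁺, dI⁺, dB⁺)`; **(BCᴸ) `SoftBregmanCoerciveP … c`** — ANALYTIC, LOCAL AT `y`: for the critical minimising tame
  inner-tube filling `y` and EVERY fat-tube configuration `z` that is `τ`-soft about `y`, `c · pairDevSq Rg (lab ∘ xf) y z ≤ E(z) − E(y)`;
  GLUE `offTubeSoftGapMinP_of_capture` : (BXᴸ) ∧ (KAᴸ) ∧ (BCᴸ)(c ≥ 0) ⟹ (OGˢ)(g₀ = c·(sb − sb₁)²) (all dials), `offTubeSoftGapMinP_record_of_capture`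
  ((BXᴸ′) discharged in tree, `σ ≥ 1/2`), `offTubeGapMinP_record_of_capture_hard` (∧ (OGʰ′) ⟹ (OGᴹ′)), door `mildCoherentMoatCorePG_W2h`.
0 sorry · import = tree ZZZYH only · 5 defs (2 `Prop` pieces (KAᴸ)(BCᴸ) + `pairDevSq`, `bondExcess`, `bondBregman`) · 20 theorems · no instances/notation/options · axioms standard. [g93]
-/

noncomputable section
open scoped BigOperators Classical InnerProductSpace RealInnerProductSpace
open MeasureTheory Set Metric Filter Topology
open Literature.MathematicalPhysics.StatisticalMechanics (lennardJones)

namespace Summit.AtomisticToContinuum.Crystallization.Theorems.ChartedZeroExcessLayeredLatticeLiouville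

open Summit.AtomisticToContinuum.Crystallization.Theorems.ChartedPlanarOrderRigidityDoor (E3)
open Summit.AtomisticToContinuum.Crystallization.Theorems.ChartedPlanarOrderDensityDichotomy (μS IsSep)
open Summit.AtomisticToContinuum.Crystallization.Theorems.ChartedPlanarOrderCleanScaleP (IsCleanP IsDoorSetP)
open Summit.AtomisticToContinuum.Crystallization.Theorems.ChartedPlanarOrderMesoCut (LayeredHom EnvClose)
open Summit.AtomisticToContinuum.Crystallization.Theorems.ChartedPlanarOrderDoorLayeredOsc (IsTwoShellAffineGood)
open Summit.AtomisticToContinuum.Crystallization.Theorems.ChartedPlanarOrderNashForceBalance (ljDeriv pairDeriv)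

/-! ### ZZZYI-1  (K) The pair-deviation energy, the exit mass and the rotated star (kinematic, LJ-free, PROVED) -/

section PairDev

variable {n : ℕ}

/-- ★ **`pairDevSq Rg y₀ y z` — THE PAIR-DEVIATION ENERGY of `z` relative to `y` on the `Rg`-label graph of `y₀`**: the sum over ordered label pairs
`dist (y₀ i) (y₀ j) ≤ Rg` of `‖(z i − z j) − (y i − y j)‖²` (the discrete `H¹`-seminorm of the displacement `z − y`). [this file, g93 · kinematic] -/
def pairDevSq (Rg : ℝ) (y₀ y z : Fin n → E3) : ℝ :=
  ∑ i, ∑ j, if dist (y₀ i) (y₀ j) ≤ Rg then ‖(z i - z j) - (y i - y j)‖ ^ 2 else 0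

/-- Each summand of `pairDevSq` is non-negative. [formal bookkeeping] -/
theorem pairDevSq_term_nonneg (Rg : ℝ) (y₀ y z : Fin n → E3) (i j : Fin n) :
    0 ≤ (if dist (y₀ i) (y₀ j) ≤ Rg then ‖(z i - z j) - (y i - y j)‖ ^ 2 else 0) := by
  split_ifs <;> positivity

/-- `pairDevSq` is non-negative (a sum of non-negative terms). [formal bookkeeping] -/
theorem pairDevSq_nonneg (Rg : ℝ) (y₀ y z : Fin n → E3) : 0 ≤ pairDevSq Rg y₀ y z :=
  Finset.sum_nonneg fun i _ => Finset.sum_nonneg fun j _ => pairDevSq_term_nonneg Rg y₀ y z i j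

/-- CONSISTENCY GUARD: the filling has zero pair-deviation energy relative to itself (so (BCᴸ) below reads `0 ≤ 0` at `z = y`). [formal bookkeeping] -/
theorem pairDevSq_self (Rg : ℝ) (y₀ y : Fin n → E3) : pairDevSq Rg y₀ y y = 0 := by
  unfold pairDevSq
  simp

/-- one label pair is dominated by the whole pair-deviation energy. [this file, g93] -/
theorem sq_le_pairDevSq {Rg : ℝ} {y₀ y z : Fin n → E3} {i j : Fin n} (hij : dist (y₀ i) (y₀ j) ≤ Rg) :
    ‖(z i - z j) - (y i - y j)‖ ^ 2 ≤ pairDevSq Rg y₀ y z := by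
  unfold pairDevSq
  calc ‖(z i - z j) - (y i - y j)‖ ^ 2 = (if dist (y₀ i) (y₀ j) ≤ Rg then ‖(z i - z j) - (y i - y j)‖ ^ 2 else 0) := by rw [if_pos hij]
    _ ≤ ∑ j', (if dist (y₀ i) (y₀ j') ≤ Rg then ‖(z i - z j') - (y i - y j')‖ ^ 2 else 0) :=
        Finset.single_le_sum (fun j' _ => pairDevSq_term_nonneg Rg y₀ y z i j') (Finset.mem_univ j)
    _ ≤ ∑ i', ∑ j', (if dist (y₀ i') (y₀ j') ≤ Rg then ‖(z i' - z j') - (y i' - y j')‖ ^ 2 else 0) :=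
        Finset.single_le_sum (f := fun i' => ∑ j', (if dist (y₀ i') (y₀ j') ≤ Rg then ‖(z i' - z j') - (y i' - y j')‖ ^ 2 else 0))
          (fun i' _ => Finset.sum_nonneg fun j' _ => pairDevSq_term_nonneg Rg y₀ y z i' j') (Finset.mem_univ i)

/-- ★★ **THE EXIT MASS (PROVED)**: a bond exit `> sb` against the label crystal at an `Rg`-label pair, with the filling `y` in the inner tube (`sb₁ ≤ sb`),
puts `≥ (sb − sb₁)²` into the pair-deviation energy of `z` relative to `y`. [this file, g93 · kinematic] -/
theorem exitMass_le_pairDevSq {X : Set E3} {Rg sb sb₁ dI₁ dB₁ : ℝ} {y₀ y z : Fin n → E3} (hy : y ∈ bondTube X Rg sb₁ dI₁ dB₁ y₀) {i j : Fin n}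
    (hij : dist (y₀ i) (y₀ j) ≤ Rg) (hex : sb < dist (z i - z j) (y₀ i - y₀ j)) (hsb : sb₁ ≤ sb) :
    (sb - sb₁) ^ 2 ≤ pairDevSq Rg y₀ y z := by
  have hyb : dist (y i - y j) (y₀ i - y₀ j) ≤ sb₁ := (mem_bondTube_iff.1 hy).1 i j hij
  have htri : dist (z i - z j) (y₀ i - y₀ j) ≤ ‖(z i - z j) - (y i - y j)‖ + dist (y i - y j) (y₀ i - y₀ j) := by
    rw [← dist_eq_norm]; exact dist_triangle _ _ _
  have hlow : sb - sb₁ ≤ ‖(z i - z j) - (y i - y j)‖ := by linarith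
  have h0 : 0 ≤ sb - sb₁ := by linarith
  exact (pow_le_pow_left₀ h0 hlow 2).trans (sq_le_pairDevSq hij)

/-- ★★ **THE ROTATED STAR (PROVED)**: if the pair `(i, j)` exits (`> sb` against the label crystal), the filling `y` keeps the pair within `sb₁`, and a witness
isometry `V` carries the `y`-bond to the `z`-bond up to `τ`, then `V` rotates the REFERENCE bond `y₀ j − y₀ i` by more than `sb − sb₁ − τ`. [this file, g93] -/
theorem rotatedStar_of_exit {sb sb₁ τ : ℝ} {y₀ y z : Fin n → E3} (V : E3 ≃ₗᵢ[ℝ] E3) {i j : Fin n}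
    (hsoft : ‖(z j - z i) - V (y j - y i)‖ ≤ τ) (hyb : dist (y i - y j) (y₀ i - y₀ j) ≤ sb₁) (hex : sb < dist (z i - z j) (y₀ i - y₀ j)) :
    sb - sb₁ - τ < ‖V (y₀ j - y₀ i) - (y₀ j - y₀ i)‖ := by
  have hex' : sb < ‖(z j - z i) - (y₀ j - y₀ i)‖ := by
    rw [dist_eq_norm, ← norm_neg] at hex
    have e : -(z i - z j - (y₀ i - y₀ j)) = (z j - z i) - (y₀ j - y₀ i) := by abel
    rwa [e] at hex
  have hV : ‖V (y j - y i) - V (y₀ j - y₀ i)‖ ≤ sb₁ := by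
    rw [← map_sub, LinearIsometryEquiv.norm_map]
    rw [dist_eq_norm, ← norm_neg] at hyb
    have e : -(y i - y j - (y₀ i - y₀ j)) = (y j - y i) - (y₀ j - y₀ i) := by abel
    rwa [e] at hyb
  have hsum : (z j - z i) - (y₀ j - y₀ i) = ((z j - z i) - V (y j - y i)) + (V (y j - y i) - V (y₀ j - y₀ i)) + (V (y₀ j - y₀ i) - (y₀ j - y₀ i)) := by
    abel
  have h3 := norm_add₃_le (a := (z j - z i) - V (y j - y i)) (b := V (y j - y i) - V (y₀ j - y₀ i)) (c := V (y₀ j - y₀ i) - (y₀ j - y₀ i))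
  rw [← hsum] at h3
  linarith

/-- ★★ **RIDER r2 — THE SOFT CORE'S ROTATED BOND-EXIT STAR (PROVED, all dials; all three branches of `exit_by_motion_record` fold into this one).**
Under the binders of (BXᴸ) and given (BXᴸ): off the outer tube `(Rg, sb, dI, dB)`, with `y` in the inner tube `(sb₁, dI₁, dB₁)` and ANY field of isometries `V`
carrying the `y`-stars to the `xf`-stars up to `τ` at pair range `Rg`, some `Rg`-label pair `i ≠ j` has bond exit `> sb` AND its star isometry moves the
reference bond by `> sb − sb₁ − τ`. [this file, g93] -/
theorem exists_rotatedStar_of_soft {ϑc ϑp r rΘ q rsh ρ rm σ ϑr Rs ε rI ℓ Rg sb dI dB sb₁ dI₁ dB₁ τ aHi Λ θ s : ℝ}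
    (hBX : OffTubeBondExitP ϑc ϑp r rΘ q rsh ρ rm σ ϑr Rs ε rI ℓ Rg sb dI dB aHi Λ θ s) :
    ∀ δ : ℝ, 0 < δ → ∀ a : ℝ, 0 < a →
    ∀ S : Set E3, IsDoorSetP aHi δ S → (∀ z : E3, Summable fun y : S => lennardJones (dist z (y : E3))) →
      (∀ p ∈ S, IsTwoShellAffineGood θ S p) →
        ∀ (L : E3 ≃L[ℝ] E3) (w : ℤ → E3), IsEquilChart a s Λ L w →
          ∀ (x₀ : E3) (K : Set E3), K ⊆ S → (∀ k ∈ K, dist k x₀ ≤ q) →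
            IsTameOn ϑp S (LayeredHom (L : E3 →L[ℝ] E3) w) (coreOf S K rm) →
              IsTameOn ϑc S (LayeredHom (L : E3 →L[ℝ] E3) w) (moatIn S K r (r + rsh)) →
                ∀ (n : ℕ) (xf : Fin n → E3), Function.Injective xf → Set.range xf = coreOf S K ρ →
                  ∀ (L' : E3 →L[ℝ] E3) (w' : ℤ → E3) (U : E3 ≃ₗᵢ[ℝ] E3) (t : E3),
                    IsCoolShadowCrystal σ ϑr Rs ε r rI ℓ S K (LayeredHom (L : E3 →L[ℝ] E3) w) L' w' U t →
                      ∀ lab : E3 → E3, IsBondLabel ε rΘ ℓ S K (placedCrystal L' w' U t) lab →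
                        xf ∉ bondTube (S \ coreOf S K ρ) Rg sb dI dB (fun i => lab (xf i)) →
                          ∀ y ∈ bondTube (S \ coreOf S K ρ) Rg sb₁ dI₁ dB₁ (fun i => lab (xf i)),
                            ∀ V : Fin n → (E3 ≃ₗᵢ[ℝ] E3), (∀ i j, dist (lab (xf i)) (lab (xf j)) ≤ Rg → ‖(xf j - xf i) - V i (y j - y i)‖ ≤ τ) →
                              ∃ i j : Fin n, i ≠ j ∧ dist (lab (xf i)) (lab (xf j)) ≤ Rg ∧
                                sb < dist (xf i - xf j) (lab (xf i) - lab (xf j)) ∧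
                                  sb - sb₁ - τ < ‖V i (lab (xf j) - lab (xf i)) - (lab (xf j) - lab (xf i))‖ := by
  intro δ hδ a ha S hS hsum hgood L w hLw x₀ K hKS hKq hmild hcool n xf hxf hrange L' w' U t hC lab hlab hoff y hy V hV
  obtain ⟨i, j, hij, hRg, hex⟩ := hBX δ hδ a ha S hS hsum hgood L w hLw x₀ K hKS hKq hmild hcool n xf hxf hrange L' w' U t hC lab hlab hoff
  have hyb : dist (y i - y j) (lab (xf i) - lab (xf j)) ≤ sb₁ := (mem_bondTube_iff.1 hy).1 i j hRg
  exact ⟨i, j, hij, hRg, hex, rotatedStar_of_exit (y₀ := fun i => lab (xf i)) (V i) (hV i j hRg) hyb hex⟩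

/-- ★★ **THE SAME AT THE RECORD DIALS (PROVED)** — (BXᴸ′)·(UXᴸ′) discharged by tree ZZZYA for every `σ ≥ 1/2`: off the outer tube
`(121/25, 249/5000, 249/5000, 21/50)` a `τ`-soft core about an inner-tube filling has a star rotated by `> 249/5000 − sb₁ − τ`
(`≥ sb/4 = 249/20000` at `4sb₁ ≤ sb`, `τ⋆ = 249/10000`). [this file, g93] -/
theorem exists_rotatedStar_of_soft_record {σ ϑc sb₁ dI₁ dB₁ τ : ℝ} (hσ : 1 / 2 ≤ σ) :
    ∀ δ : ℝ, 0 < δ → ∀ a : ℝ, 0 < a →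
    ∀ S : Set E3, IsDoorSetP 1 δ S → (∀ z : E3, Summable fun y : S => lennardJones (dist z (y : E3))) →
      (∀ p ∈ S, IsTwoShellAffineGood (1 / 16) S p) →
        ∀ (L : E3 ≃L[ℝ] E3) (w : ℤ → E3), IsEquilChart a (1 / 50) 2 L w →
          ∀ (x₀ : E3) (K : Set E3), K ⊆ S → (∀ k ∈ K, dist k x₀ ≤ 4) →
            IsTameOn (1 / 10) S (LayeredHom (L : E3 →L[ℝ] E3) w) (coreOf S K 16) →
              IsTameOn ϑc S (LayeredHom (L : E3 →L[ℝ] E3) w) (moatIn S K 8 (8 + 12)) →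
                ∀ (n : ℕ) (xf : Fin n → E3), Function.Injective xf → Set.range xf = coreOf S K 16 →
                  ∀ (L' : E3 →L[ℝ] E3) (w' : ℤ → E3) (U : E3 ≃ₗᵢ[ℝ] E3) (t : E3),
                    IsCoolShadowCrystal σ (1 / 10000) 5 (1 / 10000) 8 10 (43 / 2) S K (LayeredHom (L : E3 →L[ℝ] E3) w) L' w' U t →
                      ∀ lab : E3 → E3, IsBondLabel (1 / 10000) (145 / 16) (43 / 2) S K (placedCrystal L' w' U t) lab →
                        xf ∉ bondTube (S \ coreOf S K 16) (121 / 25) (249 / 5000) (249 / 5000) (21 / 50) (fun i => lab (xf i)) →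
                          ∀ y ∈ bondTube (S \ coreOf S K 16) (121 / 25) sb₁ dI₁ dB₁ (fun i => lab (xf i)),
                            ∀ V : Fin n → (E3 ≃ₗᵢ[ℝ] E3), (∀ i j, dist (lab (xf i)) (lab (xf j)) ≤ 121 / 25 → ‖(xf j - xf i) - V i (y j - y i)‖ ≤ τ) →
                              ∃ i j : Fin n, i ≠ j ∧ dist (lab (xf i)) (lab (xf j)) ≤ 121 / 25 ∧
                                249 / 5000 < dist (xf i - xf j) (lab (xf i) - lab (xf j)) ∧
                                  249 / 5000 - sb₁ - τ < ‖V i (lab (xf j) - lab (xf i)) - (lab (xf j) - lab (xf i))‖ :=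
  exists_rotatedStar_of_soft (offTubeBondExitP_fat_sigma (offTubeBulkExitP_fat_sigma hσ))

end PairDev

/-! ### ZZZYI-2  (E) The exact second-order ledger of one bond (real analysis, PROVED) -/

section Bregman

/-- ★ **`bondExcess b v` — THE TRANSVERSE EXCESS of the bond `b` under the relative displacement `v`**: `‖b + v‖ − ‖b‖ − ⟪b, v⟫/‖b‖`, the length change beyond its
linearisation (`≥ 0`, `≤ ‖v‖²/‖b‖`; to leading order `‖v_⊥‖²/(2‖b‖)`).  Multiplied by the bond tension `φ'(‖b‖)` it is the PRE-STRESS term of the ledger. -/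
def bondExcess (b v : E3) : ℝ := ‖b + v‖ - ‖b‖ - ⟪b, v⟫ / ‖b‖

/-- ★ **`bondBregman φ φ' l l'` — THE SCALAR BREGMAN REMAINDER** of the pair potential `φ` (derivative table `φ'`) between the lengths `l` and `l'`:
`φ l' − φ l − φ' l · (l' − l)` (`≥ (m/2)(l' − l)²` where `φ'' ≥ m`; the STRETCH term of the ledger). -/
def bondBregman (φ φ' : ℝ → ℝ) (l l' : ℝ) : ℝ := φ l' - φ l - φ' l * (l' - l)

/-- ★★ **THE EXACT SECOND-ORDER LEDGER OF ONE BOND (PROVED)**: pair energy change − its linearisation = TENSION × TRANSVERSE EXCESS + STRETCH BREGMAN.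
An identity (no smallness, any `φ`, `φ'`). [this file, g93 · the first analytic lemma] -/
theorem pair_ledger (φ φ' : ℝ → ℝ) (b v : E3) :
    φ ‖b + v‖ - φ ‖b‖ - φ' ‖b‖ * ‖b‖⁻¹ * ⟪b, v⟫ = φ' ‖b‖ * bondExcess b v + bondBregman φ φ' ‖b‖ ‖b + v‖ := by
  unfold bondExcess bondBregman
  ring

/-- ★ the transverse excess is NONNEGATIVE (Cauchy–Schwarz; `b = 0` included by the junk value `x/0 = 0`). [this file, g93] -/
theorem bondExcess_nonneg (b v : E3) : 0 ≤ bondExcess b v := by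
  unfold bondExcess
  by_cases hb : b = 0
  · subst hb; simp
  have hnb : 0 < ‖b‖ := norm_pos_iff.2 hb
  have h1 : ⟪b, b + v⟫ ≤ ‖b‖ * ‖b + v‖ := real_inner_le_norm b (b + v)
  rw [inner_add_right, real_inner_self_eq_norm_sq] at h1
  have h2 : ⟪b, v⟫ / ‖b‖ ≤ ‖b + v‖ - ‖b‖ := by
    rw [div_le_iff₀ hnb]
    nlinarith
  linarith

/-- ★★ **THE TRANSVERSE EXCESS IS QUADRATICALLY SMALL (PROVED, no smallness of `v`)**: `bondExcess b v ≤ ‖v‖²/‖b‖` for `b ≠ 0` — so the pre-stress term of a bond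
of length `ℓ` under tension `φ'(ℓ) < 0` (compression) costs at most `|φ'(ℓ)|/ℓ · ‖v‖²` (g92's TERM A, per bond, exactly). [this file, g93] -/
theorem bondExcess_le_sq_div {b : E3} (hb : b ≠ 0) (v : E3) : bondExcess b v ≤ ‖v‖ ^ 2 / ‖b‖ := by
  unfold bondExcess
  have hnb : 0 < ‖b‖ := norm_pos_iff.2 hb
  have hsq : ‖b + v‖ ^ 2 = ‖b‖ ^ 2 + 2 * ⟪b, v⟫ + ‖v‖ ^ 2 := norm_add_sq_real b v
  have hin : |⟪b, v⟫| ≤ ‖b‖ * ‖v‖ := abs_real_inner_le_norm b v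
  have hT : 0 ≤ ‖b‖ ^ 2 + ⟪b, v⟫ + ‖v‖ ^ 2 := by
    nlinarith [(abs_le.1 hin).1, sq_nonneg (‖b‖ - ‖v‖), norm_nonneg v]
  have hkey : ‖b‖ * ‖b + v‖ ≤ ‖b‖ ^ 2 + ⟪b, v⟫ + ‖v‖ ^ 2 := by
    by_contra hlt
    push Not at hlt
    have hlt2 := mul_self_lt_mul_self hT hlt
    have h5 : (‖b‖ * ‖b + v‖) * (‖b‖ * ‖b + v‖) = ‖b‖ ^ 2 * (‖b‖ ^ 2 + 2 * ⟪b, v⟫ + ‖v‖ ^ 2) := by rw [← hsq]; ring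
    nlinarith [sq_nonneg (⟪b, v⟫ + ‖v‖ ^ 2), sq_nonneg (‖b‖ * ‖v‖)]
  have key2 : ‖b + v‖ - ‖b‖ ≤ (⟪b, v⟫ + ‖v‖ ^ 2) / ‖b‖ := by
    rw [le_div_iff₀ hnb]
    nlinarith
  rw [add_div] at key2
  linarith

/-- ★★ **THE LEDGER IN THE TREE'S TERMS (PROVED)**: for the Lennard-Jones pair term and N-force-balance's `pairDeriv x q` (the Fréchet derivative of
`x ↦ V(‖x − q‖)`): `V(‖x + v − q‖) − V(‖x − q‖) − pairDeriv x q v = ljDeriv ‖x − q‖ · bondExcess (x − q) v + bondBregman V ljDeriv ‖x − q‖ ‖x − q + v‖`.  Summed over the bonds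
of a CRITICAL filling the `pairDeriv` terms cancel (the derivative of the clamped energy vanishes), so the energy difference is the bondwise sum of the two
signed second-order terms. [this file, g93] -/
theorem lennardJones_pair_ledger (x q v : E3) :
    lennardJones ‖x + v - q‖ - lennardJones ‖x - q‖ - pairDeriv x q v =
      ljDeriv ‖x - q‖ * bondExcess (x - q) v + bondBregman lennardJones ljDeriv ‖x - q‖ ‖x - q + v‖ := by
  have happ : pairDeriv x q v = ljDeriv ‖x - q‖ * ‖x - q‖⁻¹ * ⟪x - q, v⟫ := by
    simp only [ChartedPlanarOrderNashForceBalance.pairDeriv, _root_.smul_apply, innerSL_apply_apply, smul_eq_mul]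
  have e : x + v - q = x - q + v := by abel
  rw [happ, e]
  exact pair_ledger lennardJones ljDeriv (x - q) v

end Bregman

/-! ### ZZZYI-3  The cut: (KAᴸ) kinematic capture, (BCᴸ) local Bregman coercivity, the PROVED glue and the door -/

section Pieces

/-- ★★★ **(KAᴸ) «SoftCaptureP … Rg sb₁ dI₁ dB₁ sb⁺ dI⁺ dB⁺ Rd τ …» — KINEMATIC CAPTURE OF SOFT CORES.**  Under the binders of (BXᴸ) up to the bond label: for
every filling `y` of the INNER tube `bondTube (S ∖ core) Rg sb₁ dI₁ dB₁ (lab ∘ xf)` about which the core is `τ`-SOFT at pair range `Rd`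
(`IsSoftAbout Rd τ (lab ∘ xf) y xf`), the core lies in the FAT tube `bondTube (S ∖ core) Rg sb⁺ dI⁺ dB⁺ (lab ∘ xf)`.  KINEMATIC · LJ-free · energy-free · NEW ·
UNDECIDED · TRUE-type at the record dials for fat radii of the order `(sb⁺, dI⁺, dB⁺) ≈ (1/2, 1/2, 9/10)` (symbolic here; the door keeps them free):
interface sites are registered (`ε ≤ dI⁺`); the registered annulus pins each of its stars' witness rotation to `≲ (τ + sb₁ + 2ε)/Rd`, soft stars overlap so
neighbouring witness rotations differ by `≤ 3τ/ℓ_common`, and every hot label is `≤ 3` `Rd`-hops from the annulus ⇒ star rotations `≲ 0.02–0.07`, bond deviations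
`≲ 0.35`, site deviations `≲ 0.9` by crude hop counting (smooth soft fields: far less) — the fat radii of record are an instrument output («SoftCapture-T»), in
tension with (BCᴸ) (which wants them small).  ATTACKABLE-M (label-chain telescoping as in tree (UXᴸ′); no energy) · monotone in the fat radii (`.mono`).
Why it might fail: only by mis-dialling the fat radii (a hot label needing more `Rd`-hops than the core geometry `ρ = 16`, `r = 8`, `Rd = 121/25` allows).
Sources: tree ZZZU/ZZZYA ((UXᴸ′) label chains), ZZZYG (`IsSoftAbout`). [this file, g93] -/
def SoftCaptureP (ϑc ϑp r rΘ q rsh ρ rm σ ϑr Rs ε rI ℓ Rg sb₁ dI₁ dB₁ sbp dIp dBp Rd τ aHi Λ θ s : ℝ) : Prop :=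
  ∀ δ : ℝ, 0 < δ → ∀ a : ℝ, 0 < a →
    ∀ S : Set E3, IsDoorSetP aHi δ S → (∀ z : E3, Summable fun y : S => lennardJones (dist z (y : E3))) →
      (∀ p ∈ S, IsTwoShellAffineGood θ S p) →
        ∀ (L : E3 ≃L[ℝ] E3) (w : ℤ → E3), IsEquilChart a s Λ L w →
          ∀ (x₀ : E3) (K : Set E3), K ⊆ S → (∀ k ∈ K, dist k x₀ ≤ q) →
            IsTameOn ϑp S (LayeredHom (L : E3 →L[ℝ] E3) w) (coreOf S K rm) →
              IsTameOn ϑc S (LayeredHom (L : E3 →L[ℝ] E3) w) (moatIn S K r (r + rsh)) →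
                ∀ (n : ℕ) (xf : Fin n → E3), Function.Injective xf → Set.range xf = coreOf S K ρ →
                  ∀ (L' : E3 →L[ℝ] E3) (w' : ℤ → E3) (U : E3 ≃ₗᵢ[ℝ] E3) (t : E3),
                    IsCoolShadowCrystal σ ϑr Rs ε r rI ℓ S K (LayeredHom (L : E3 →L[ℝ] E3) w) L' w' U t →
                      ∀ lab : E3 → E3, IsBondLabel ε rΘ ℓ S K (placedCrystal L' w' U t) lab →
                        ∀ y ∈ bondTube (S \ coreOf S K ρ) Rg sb₁ dI₁ dB₁ (fun i => lab (xf i)),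
                          IsSoftAbout Rd τ (fun i => lab (xf i)) y xf →
                            xf ∈ bondTube (S \ coreOf S K ρ) Rg sbp dIp dBp (fun i => lab (xf i))

/-- ★★★ **(BCᴸ) «SoftBregmanCoerciveP … Rg sb₁ dI₁ dB₁ sb⁺ dI⁺ dB⁺ Rd τ c …» — LOCAL BREGMAN COERCIVITY OF THE CLAMPED ENERGY AT THE CRITICAL FILLING, ON
THE SOFT CONE.**  Binders of (OGˢ) for the door set, the mild core `xf` (which only supplies the LABEL GEOMETRY `lab ∘ xf`), the crystal, the label and the
filling `y` (inner tube, injective, disjoint from the exterior, CRITICAL `HasFDerivAt (clampedEnergy (S ∖ core)) 0 y`, `ϑ`-tame stars, minimising over the inner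
tube); conclusion: for EVERY configuration `z` of the FAT tube `bondTube (S ∖ core) Rg sb⁺ dI⁺ dB⁺ (lab ∘ xf)` that is `τ`-SOFT about `y` at range `Rd`,
`c · pairDevSq Rg (lab ∘ xf) y z ≤ clampedEnergy (S ∖ core) z − clampedEnergy (S ∖ core) y`.  The right side IS the BREGMAN DIVERGENCE of the clamped energy
at `y` (its derivative vanishes); by `lennardJones_pair_ledger` it is the bond sum of TENSION × EXCESS (`|·| ≤ |φ'|/ℓ · |Δw|²`, `bondExcess_le_sq_div`) and STRETCH
BREGMAN (`≥ ½ min φ'' · Δℓ²` on the nearest-neighbour window).  ANALYTIC · ENERGETIC · LOCAL (the landscape at `y` over ALL soft fat-tube configurations — not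
only actual cores, not only off-tube ones) · NEW · UNDECIDED · TRUE-type by the desk estimate: clamped Korn on the label graph (rim term supplied by the EXTERIOR
BONDS of the energy itself, `C_K ≈ 2–4`), nearest-neighbour stiffness `φ'' ≈ 10` against compression pre-stress `|φ'|/ℓ ≈ 0.2` and far-shell concavity, cubic
corrections `≤ 20 %` on the soft cone (g92 FINDING «NO-PRESSURE-WINDOW»: acoustic-tensor margin `≥ 8` for `ℓ_NN ∈ [27/32, 1.05]`).  STRONGER in form than
(OGˢ) (in-tube and non-core `z`, quadratic modulus), WEAKER than the summit; with (KAᴸ) and the PROVED exit mass it implies (OGˢ) (`offTubeSoftGapMinP_of_capture`).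
FIRST RUNG: the infinitesimal periodic version is LATTICE STABILITY `Λ > 0` (Ortner–Theil 2012 §5.2; Hudson–Ortner 2012), decidable by Bloch diagonalisation.
INSTRUMENTABLE «SoftHessian-T»: least eigenvalue of the clamped pre-stressed Hessian of record label patches (radius `16`, all stackings) in the
`pairDevSq`-metric, two-sided (a negative eigenvalue refutes (BCᴸ) at every `c ≥ 0`).  Antitone in `c` (`.of_le`); `c = 0` = minimality of `y` on the soft fat cone.
Why it might fail: a record label crystal dialled near the Lennard-Jones inflection (`ℓ_NN ≳ 1.075`, tension) loses ellipticity (g92 table: margin `< 0` at `1.08`)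
— excluded only if `IsEquilChart`/tameness pin the nearest-neighbour window below it; or fat radii so large that the soft cone leaves the cubic regime.
Sources: arXiv:1202.3858 §5.2 (lattice stability `Λ`), doi:10.1051/m2an/2011014 (Hudson–Ortner), doi:10.1007/s00205-015-0862-1 (Flatley–Theil, fcc local
minimality), arXiv:1601.05968 Thm 1.1 / book:kruzik2019 p.767 (rigidity / Korn), STATUS «NO-PRESSURE-WINDOW» (g92). [this file, g93] -/
def SoftBregmanCoerciveP (ϑc ϑ ϑp r rΘ q rsh ρ rm σ ϑr Rs ε rI ℓ Rg sb₁ dI₁ dB₁ sbp dIp dBp Rd τ c aHi Λ θ s : ℝ) : Prop :=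
  ∀ δ : ℝ, 0 < δ → ∀ a : ℝ, 0 < a →
    ∀ S : Set E3, IsDoorSetP aHi δ S → (∀ z : E3, Summable fun y : S => lennardJones (dist z (y : E3))) →
      (∀ p ∈ S, IsTwoShellAffineGood θ S p) →
        ∀ (L : E3 ≃L[ℝ] E3) (w : ℤ → E3), IsEquilChart a s Λ L w →
          ∀ (x₀ : E3) (K : Set E3), K ⊆ S → (∀ k ∈ K, dist k x₀ ≤ q) →
            IsTameOn ϑp S (LayeredHom (L : E3 →L[ℝ] E3) w) (coreOf S K rm) →
              IsTameOn ϑc S (LayeredHom (L : E3 →L[ℝ] E3) w) (moatIn S K r (r + rsh)) →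
                ∀ (n : ℕ) (xf : Fin n → E3), Function.Injective xf → Set.range xf = coreOf S K ρ →
                  ∀ (L' : E3 →L[ℝ] E3) (w' : ℤ → E3) (U : E3 ≃ₗᵢ[ℝ] E3) (t : E3),
                    IsCoolShadowCrystal σ ϑr Rs ε r rI ℓ S K (LayeredHom (L : E3 →L[ℝ] E3) w) L' w' U t →
                      ∀ lab : E3 → E3, IsBondLabel ε rΘ ℓ S K (placedCrystal L' w' U t) lab →
                        ∀ y ∈ bondTube (S \ coreOf S K ρ) Rg sb₁ dI₁ dB₁ (fun i => lab (xf i)),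
                          Function.Injective y → Disjoint (Set.range y) (S \ coreOf S K ρ) →
                            HasFDerivAt (fun z : Fin n → E3 => clampedEnergy (S \ coreOf S K ρ) z) (0 : (Fin n → E3) →L[ℝ] ℝ) y →
                              (∀ i, IsTameStar ϑ ((S \ coreOf S K ρ) ∪ Set.range y) (LayeredHom (L : E3 →L[ℝ] E3) w) (y i)) →
                              (∀ z ∈ bondTube (S \ coreOf S K ρ) Rg sb₁ dI₁ dB₁ (fun i => lab (xf i)),
                                  clampedEnergy (S \ coreOf S K ρ) y ≤ clampedEnergy (S \ coreOf S K ρ) z) →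
                                ∀ z ∈ bondTube (S \ coreOf S K ρ) Rg sbp dIp dBp (fun i => lab (xf i)),
                                  IsSoftAbout Rd τ (fun i => lab (xf i)) y z →
                                    c * pairDevSq Rg (fun i => lab (xf i)) y z ≤
                                      clampedEnergy (S \ coreOf S K ρ) z - clampedEnergy (S \ coreOf S K ρ) y

variable {ϑc ϑ ϑp r rΘ q rsh ρ rm σ ϑr Rs ε rI ℓ Rg sb dI dB sb₁ dI₁ dB₁ sbp dIp dBp sbp' dIp' dBp' Rd τ c c' g₀ g₀' aHi Λ θ s : ℝ}

/-- (KAᴸ) is monotone in the fat radii. [formal bookkeeping] -/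
theorem SoftCaptureP.mono (hs : sbp ≤ sbp') (hI : dIp ≤ dIp') (hB : dBp ≤ dBp')
    (h : SoftCaptureP ϑc ϑp r rΘ q rsh ρ rm σ ϑr Rs ε rI ℓ Rg sb₁ dI₁ dB₁ sbp dIp dBp Rd τ aHi Λ θ s) :
    SoftCaptureP ϑc ϑp r rΘ q rsh ρ rm σ ϑr Rs ε rI ℓ Rg sb₁ dI₁ dB₁ sbp' dIp' dBp' Rd τ aHi Λ θ s := by
  intro δ hδ a ha S hS hsum hgood L w hLw x₀ K hKS hKq hmild hcool n xf hxf hrange L' w' U t hC lab hlab y hy hsoft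
  exact bondTube_mono hs hI hB (h δ hδ a ha S hS hsum hgood L w hLw x₀ K hKS hKq hmild hcool n xf hxf hrange L' w' U t hC lab hlab y hy hsoft)

/-- (BCᴸ) is antitone in the modulus `c`. [formal bookkeeping] -/
theorem SoftBregmanCoerciveP.of_le (hc : c' ≤ c)
    (h : SoftBregmanCoerciveP ϑc ϑ ϑp r rΘ q rsh ρ rm σ ϑr Rs ε rI ℓ Rg sb₁ dI₁ dB₁ sbp dIp dBp Rd τ c aHi Λ θ s) :
    SoftBregmanCoerciveP ϑc ϑ ϑp r rΘ q rsh ρ rm σ ϑr Rs ε rI ℓ Rg sb₁ dI₁ dB₁ sbp dIp dBp Rd τ c' aHi Λ θ s := by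
  intro δ hδ a ha S hS hsum hgood L w hLw x₀ K hKS hKq hmild hcool n xf hxf hrange L' w' U t hC lab hlab y hy hyinj hydisj hcrit htame hmin z hz hsoft
  have h1 := h δ hδ a ha S hS hsum hgood L w hLw x₀ K hKS hKq hmild hcool n xf hxf hrange L' w' U t hC lab hlab y hy hyinj hydisj hcrit htame hmin z hz hsoft
  have h2 := mul_le_mul_of_nonneg_right hc (pairDevSq_nonneg Rg (fun i => lab (xf i)) y z)
  linarith

/-- (OGˢ) is antitone in the gap. [formal bookkeeping] -/
theorem OffTubeSoftGapMinP.of_le (hg : g₀' ≤ g₀)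
    (h : OffTubeSoftGapMinP ϑc ϑ ϑp r rΘ q rsh ρ rm σ ϑr Rs ε rI ℓ Rg sb dI dB sb₁ dI₁ dB₁ Rd τ g₀ aHi Λ θ s) :
    OffTubeSoftGapMinP ϑc ϑ ϑp r rΘ q rsh ρ rm σ ϑr Rs ε rI ℓ Rg sb dI dB sb₁ dI₁ dB₁ Rd τ g₀' aHi Λ θ s := by
  intro δ hδ a ha S hS hsum hgood L w hLw x₀ K hKS hKq hmild hcool n xf hxf hrange L' w' U t hC lab hlab hoff y hyT hyinj hydisj hcrit htame hmin hsoft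
  have := h δ hδ a ha S hS hsum hgood L w hLw x₀ K hKS hKq hmild hcool n xf hxf hrange L' w' U t hC lab hlab hoff y hyT hyinj hydisj hcrit htame hmin hsoft
  linarith

/-- (OGʰ) is antitone in the gap. [formal bookkeeping] -/
theorem OffTubeHardGapMinP.of_le (hg : g₀' ≤ g₀)
    (h : OffTubeHardGapMinP ϑc ϑ ϑp r rΘ q rsh ρ rm σ ϑr Rs ε rI ℓ Rg sb dI dB sb₁ dI₁ dB₁ Rd τ g₀ aHi Λ θ s) :
    OffTubeHardGapMinP ϑc ϑ ϑp r rΘ q rsh ρ rm σ ϑr Rs ε rI ℓ Rg sb dI dB sb₁ dI₁ dB₁ Rd τ g₀' aHi Λ θ s := by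
  intro δ hδ a ha S hS hsum hgood L w hLw x₀ K hKS hKq hmild hcool n xf hxf hrange L' w' U t hC lab hlab hoff y hyT hyinj hydisj hcrit htame hmin hhard
  have := h δ hδ a ha S hS hsum hgood L w hLw x₀ K hKS hKq hmild hcool n xf hxf hrange L' w' U t hC lab hlab hoff y hyT hyinj hydisj hcrit htame hmin hhard
  linarith

/-- ★★★ **THE GLUE OF NODE 93 (PROVED, all dials): (BXᴸ) ∧ (KAᴸ) ∧ (BCᴸ)(c ≥ 0) ⟹ (OGˢ)(g₀ = c·(sb − sb₁)²)** for `sb₁ ≤ sb`.  A soft off-tube core exits by a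
bond (BX); it is captured in the fat tube (KA); the Bregman coercivity at the critical filling (BC) bounds `E(xf) − E(y)` below by `c · pairDevSq`, and the exit
pair alone weighs `(sb − sb₁)²` (`exitMass_le_pairDevSq`). [this file, g93] -/
theorem offTubeSoftGapMinP_of_capture (hsb : sb₁ ≤ sb) (hc : 0 ≤ c)
    (hBX : OffTubeBondExitP ϑc ϑp r rΘ q rsh ρ rm σ ϑr Rs ε rI ℓ Rg sb dI dB aHi Λ θ s)
    (hKA : SoftCaptureP ϑc ϑp r rΘ q rsh ρ rm σ ϑr Rs ε rI ℓ Rg sb₁ dI₁ dB₁ sbp dIp dBp Rd τ aHi Λ θ s)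
    (hBC : SoftBregmanCoerciveP ϑc ϑ ϑp r rΘ q rsh ρ rm σ ϑr Rs ε rI ℓ Rg sb₁ dI₁ dB₁ sbp dIp dBp Rd τ c aHi Λ θ s) :
    OffTubeSoftGapMinP ϑc ϑ ϑp r rΘ q rsh ρ rm σ ϑr Rs ε rI ℓ Rg sb dI dB sb₁ dI₁ dB₁ Rd τ (c * (sb - sb₁) ^ 2) aHi Λ θ s := by
  intro δ hδ a ha S hS hsum hgood L w hLw x₀ K hKS hKq hmild hcool n xf hxf hrange L' w' U t hC lab hlab hoff y hyT hyinj hydisj hcrit htame hmin hsoft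
  obtain ⟨i, j, _, hRg, hex⟩ := hBX δ hδ a ha S hS hsum hgood L w hLw x₀ K hKS hKq hmild hcool n xf hxf hrange L' w' U t hC lab hlab hoff
  have hcap := hKA δ hδ a ha S hS hsum hgood L w hLw x₀ K hKS hKq hmild hcool n xf hxf hrange L' w' U t hC lab hlab y hyT hsoft
  have hco := hBC δ hδ a ha S hS hsum hgood L w hLw x₀ K hKS hKq hmild hcool n xf hxf hrange L' w' U t hC lab hlab y hyT hyinj hydisj hcrit htame hmin
    xf hcap hsoft
  have hmass : (sb - sb₁) ^ 2 ≤ pairDevSq Rg (fun i => lab (xf i)) y xf := exitMass_le_pairDevSq hyT hRg hex hsb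
  have h3 := mul_le_mul_of_nonneg_left hmass hc
  linarith

/-- ★★★ **NODE 93 AT THE RECORD DIALS (PROVED): (KAᴸ′) ∧ (BCᴸ′)(c ≥ 0) ⟹ (OGˢ′)(Rd, τ, g₀ = c·(249/5000 − sb₁)²)** for every `σ ≥ 1/2`, `ϑc`, `ϑ`, inner and fat
radii, pair range `Rd` and tolerance `τ` — (BXᴸ′) is discharged by tree ZZZYA.  At `(Rd, τ) = (121/25, 249/10000)`, `σ = 27/32`, `ϑ = tameRadius` this is the leaf
OF RECORD (OGˢ′⋆). [this file, g93] -/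
theorem offTubeSoftGapMinP_record_of_capture {σ ϑc ϑ sb₁ dI₁ dB₁ sbp dIp dBp Rd τ c : ℝ} (hσ : 1 / 2 ≤ σ) (hsb : sb₁ ≤ 249 / 5000) (hc : 0 ≤ c)
    (hKA : SoftCaptureP ϑc (1 / 10) 8 (145 / 16) 4 12 16 16 σ (1 / 10000) 5 (1 / 10000) 10 (43 / 2) (121 / 25) sb₁ dI₁ dB₁ sbp dIp dBp Rd τ 1 2
      (1 / 16) (1 / 50))
    (hBC : SoftBregmanCoerciveP ϑc ϑ (1 / 10) 8 (145 / 16) 4 12 16 16 σ (1 / 10000) 5 (1 / 10000) 10 (43 / 2) (121 / 25) sb₁ dI₁ dB₁ sbp dIp dBp Rd τ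
      c 1 2 (1 / 16) (1 / 50)) :
    OffTubeSoftGapMinP ϑc ϑ (1 / 10) 8 (145 / 16) 4 12 16 16 σ (1 / 10000) 5 (1 / 10000) 10 (43 / 2) (121 / 25) (249 / 5000) (249 / 5000) (21 / 50)
      sb₁ dI₁ dB₁ Rd τ (c * (249 / 5000 - sb₁) ^ 2) 1 2 (1 / 16) (1 / 50) :=
  offTubeSoftGapMinP_of_capture hsb hc (offTubeBondExitP_fat_sigma (offTubeBulkExitP_fat_sigma hσ)) hKA hBC

/-- ★★ **THE RESIDUAL OF RECORD RE-EXPRESSED (PROVED): (KAᴸ′) ∧ (BCᴸ′)(c ≥ 0) ∧ (OGʰ′)(g₀) ⟹ (OGᴹ′)(min (c·(sb − sb₁)²) g₀)** at the record dials (the EQUIV layer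
`offTubeGapMinP_iff_softHard` of NODE 92 with its soft half cut by NODE 93). [this file, g93] -/
theorem offTubeGapMinP_record_of_capture_hard {σ ϑc ϑ sb₁ dI₁ dB₁ sbp dIp dBp Rd τ c g₀ : ℝ} (hσ : 1 / 2 ≤ σ) (hsb : sb₁ ≤ 249 / 5000) (hc : 0 ≤ c)
    (hKA : SoftCaptureP ϑc (1 / 10) 8 (145 / 16) 4 12 16 16 σ (1 / 10000) 5 (1 / 10000) 10 (43 / 2) (121 / 25) sb₁ dI₁ dB₁ sbp dIp dBp Rd τ 1 2
      (1 / 16) (1 / 50))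
    (hBC : SoftBregmanCoerciveP ϑc ϑ (1 / 10) 8 (145 / 16) 4 12 16 16 σ (1 / 10000) 5 (1 / 10000) 10 (43 / 2) (121 / 25) sb₁ dI₁ dB₁ sbp dIp dBp Rd τ
      c 1 2 (1 / 16) (1 / 50))
    (hH : OffTubeHardGapMinP ϑc ϑ (1 / 10) 8 (145 / 16) 4 12 16 16 σ (1 / 10000) 5 (1 / 10000) 10 (43 / 2) (121 / 25) (249 / 5000) (249 / 5000)
      (21 / 50) sb₁ dI₁ dB₁ Rd τ g₀ 1 2 (1 / 16) (1 / 50)) :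
    OffTubeGapMinP ϑc ϑ (1 / 10) 8 (145 / 16) 4 12 16 16 σ (1 / 10000) 5 (1 / 10000) 10 (43 / 2) (121 / 25) (249 / 5000) (249 / 5000) (21 / 50)
      sb₁ dI₁ dB₁ (min (c * (249 / 5000 - sb₁) ^ 2) g₀) 1 2 (1 / 16) (1 / 50) :=
  offTubeGapMinP_iff_softHard.2 ⟨(offTubeSoftGapMinP_record_of_capture hσ hsb hc hKA hBC).of_le (min_le_left _ _), hH.of_le (min_le_right _ _)⟩

/-- ★★★ **THE DOOR W2h (PROVED): `ϑc ≤ 5·10⁻¹²`, (X1ᴸ′)(lam > 0), (X2ᴸ′), (KAᴸ′), (BCᴸ′)(c > 0) and (OGʰ′⋆)(g₀ > 0) ⟹ `[MCMC♮](ϑc)`** at the registered pair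
`(Rd, τ⋆) = (121/25, 249/10000)` — the door of record `mildCoherentMoatCorePG_W2g_record` with its soft leaf replaced by NODE 93's two pieces. [this file, g93] -/
theorem mildCoherentMoatCorePG_W2h {ϑc sb₁ dI₁ dB₁ sbp dIp dBp lam c g₀ : ℝ} (hϑc : ϑc ≤ 1 / 200000000000) (hlam : 0 < lam) (hc : 0 < c) (hg₀ : 0 < g₀)
    (hsb : 4 * sb₁ ≤ 249 / 5000) (hdI : 4 * dI₁ ≤ 249 / 5000) (hdB : dB₁ ≤ 2 / 5) (hsb₀ : 0 ≤ sb₁) (hdI₀ : 0 ≤ dI₁) (hdB₀ : 0 ≤ dB₁)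
    (hX1 : LabelTubeConvexityP ϑc tameRadius (1 / 10) 8 (145 / 16) 4 12 16 16 (27 / 32) (1 / 10000) 5 (1 / 10000) 10 (43 / 2) (1 / 5000) (121 / 25)
      (249 / 5000) (249 / 5000) (21 / 50) lam 1 2 (1 / 16) (1 / 50))
    (hX2 : LabelLoadedTubeAprioriP ϑc tameRadius (1 / 10) 8 (145 / 16) 4 12 16 16 (27 / 32) (1 / 10000) 5 (1 / 10000) 10 (43 / 2) (1 / 5000)
      (121 / 25) (249 / 5000) (249 / 5000) (21 / 50) sb₁ dI₁ dB₁ 1 2 (1 / 16) (1 / 50))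
    (hKA : SoftCaptureP ϑc (1 / 10) 8 (145 / 16) 4 12 16 16 (27 / 32) (1 / 10000) 5 (1 / 10000) 10 (43 / 2) (121 / 25) sb₁ dI₁ dB₁ sbp dIp dBp
      (121 / 25) (249 / 10000) 1 2 (1 / 16) (1 / 50))
    (hBC : SoftBregmanCoerciveP ϑc tameRadius (1 / 10) 8 (145 / 16) 4 12 16 16 (27 / 32) (1 / 10000) 5 (1 / 10000) 10 (43 / 2) (121 / 25) sb₁ dI₁ dB₁
      sbp dIp dBp (121 / 25) (249 / 10000) c 1 2 (1 / 16) (1 / 50))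
    (hH : OffTubeHardGapMinP ϑc tameRadius (1 / 10) 8 (145 / 16) 4 12 16 16 (27 / 32) (1 / 10000) 5 (1 / 10000) 10 (43 / 2) (121 / 25) (249 / 5000)
      (249 / 5000) (21 / 50) sb₁ dI₁ dB₁ (121 / 25) (249 / 10000) g₀ 1 2 (1 / 16) (1 / 50)) :
    MildCoherentMoatCorePG ϑc tameRadius (1 / 10) 8 4 12 16 1 2 (1 / 16) (1 / 50) := by
  have hgap : 0 < c * (249 / 5000 - sb₁) ^ 2 := mul_pos hc (by nlinarith)
  have hmin : 0 < min (c * (249 / 5000 - sb₁) ^ 2) g₀ := lt_min hgap hg₀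
  exact mildCoherentMoatCorePG_W2g_record hϑc hlam hmin hsb hdI hdB hsb₀ hdI₀ hdB₀ hX1 hX2
    ((offTubeSoftGapMinP_record_of_capture (by norm_num) (by linarith) hc.le hKA hBC).of_le (min_le_left _ _)) (hH.of_le (min_le_right _ _))

end Pieces

end Summit.AtomisticToContinuum.Crystallization.Theorems.ChartedZeroExcessLayeredLatticeLiouville
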